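import Mathlib
import Summits.CriticalPhenomena.PercolationContinuityZ3.Theorems.PercNearOneGluingNoHeavyLowerTailFatMinorityUpsetPostFKG
import HarnessLib

/-!
# `NoHeavyLowerTail` (stmt-CriticalPhenomena-4575), line fat-minority-linear — the GENERATOR form (PF+)
# of the post-FKG inequality on every up-set of the edges at `0`

Route task `nh-dp-fatminority` (gen 10).  Setting of
`…FatMinorityUpsetPostFKG`: `μ = prodBernoulli w`, `0 = o` isolated in `G ∖ A` (`A` = ports), `b` a
target, `𝒰 ⊆ 𝒫(A)` an up-set with `∅ ∉ 𝒰`, `U = {ω | ∃ B ∈ 𝒰, ∀ u ∈ B, s(o,u) ∈ ω}`.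

(PF+) of FINDINGS-fat-minority-gen9 §4 (there a conjecture, census 0 / 3.6·10⁷): with
`s(𝒰) := min_{B ∈ 𝒰} max_{v ∈ B} P(v ↔ b)` ("the best port of the worst generator"; the minimum is
attained on a minimal member of `𝒰`),
`s(𝒰) · P(U) ≤ P(0 ↔ b, U)`, i.e. `P(0 ↔ b | U) ≥ s(𝒰)`.
It sharpens `upset_postFKG` (`min_{a ∈ A} P(a ↔ b)` in place of `s(𝒰)`).

Proof (two lines, as for (PF)): let `Q ⊆ A` meet every member of `𝒰` and let `a₀` minimise the
off-`0` reliability `P_{G∖0}(· ↔ b)` over `Q`.  For `B ∈ 𝒰` pick `v ∈ B ∩ Q`; Kozma–Nitzan's Lemma 5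
gives `P(a₀ ↔ b, σ_B) ≤ P(0 ↔ b, σ_B)`; summing over the stars `σ_B`, `B ∈ 𝒰`, gives
`P(a₀ ↔ b, U) ≤ P(0 ↔ b, U)` (`upset_thm4_comparison_attached`), and Harris gives
`P(a₀ ↔ b) P(U) ≤ P(a₀ ↔ b, U)`, whence `min_{Q} P(· ↔ b) · P(U) ≤ P(0 ↔ b, U)`
(`upset_postFKG_attached`).  Taking for `Q` the set of `P(· ↔ b)`-best ports of the members of `𝒰`
gives `min_Q P(· ↔ b) = s(𝒰)` (`upset_postFKG_generators`).
-/

namespace Summit.CriticalPhenomena.PercolationContinuityZ3.Theorems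

open MeasureTheory Set
open Literature.Probability.LatticeModels (prodBernoulli prodBernoulli_harris)
open Literature.Probability.Percolation

noncomputable section
open scoped Classical

variable {V : Type*} [Fintype V]

/-- **Theorem-4 comparison with an anchor attached to `Q`.**  `0` isolated in `G ∖ A`, `𝒰 ⊆ 𝒫(A)` an
up-set every member of which meets `Q`, and `a₀ ∈ Q` a minimiser over `Q` of the off-`0` reliability
`P_{G∖{0}}(· ↔ b)`.  Then `P(a₀ ↔ b, U) ≤ P(0 ↔ b, U)`: on each star `σ_B`, `B ∈ 𝒰`, apply Kozma–Nitzan's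
Lemma 5 with a port `v ∈ B ∩ Q`. [cite: KozmaNitzan2024, Lemma 5 (p. 13); this form: route notes FINDINGS-fat-minority-gen10] -/
theorem upset_thm4_comparison_attached (w : Sym2 V → unitInterval) (A Q : Finset V) (o b : V)
    (hoA : o ∉ A) (hiso : ∀ u, u ≠ o → u ∉ A → w s(o, u) = 0)
    (𝒰 : Finset (Finset V)) (h𝒰A : 𝒰 ⊆ A.powerset)
    (hup : ∀ B ∈ 𝒰, ∀ B' ∈ A.powerset, B ⊆ B' → B' ∈ 𝒰)
    (hQA : Q ⊆ A) (hatt : ∀ B ∈ 𝒰, (B ∩ Q).Nonempty)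
    {a₀ : V} (ha₀ : a₀ ∈ Q)
    (hmin : ∀ v ∈ Q, (prodBernoulli w).real (openConnIn ({o}ᶜ : Set V) a₀ b) ≤
      (prodBernoulli w).real (openConnIn ({o}ᶜ : Set V) v b)) :
    (prodBernoulli w).real (openConn a₀ b ∩ {ω : BondConfig V | ∃ B ∈ 𝒰, ∀ u ∈ B, s(o, u) ∈ ω}) ≤
      (prodBernoulli w).real (openConn o b ∩ {ω : BondConfig V | ∃ B ∈ 𝒰, ∀ u ∈ B, s(o, u) ∈ ω}) := by
  rw [real_inter_starUpEvent_eq_sum w A o hoA hiso 𝒰 h𝒰A hup (openConn a₀ b),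
    real_inter_starUpEvent_eq_sum w A o hoA hiso 𝒰 h𝒰A hup (openConn o b)]
  refine Finset.sum_le_sum fun B hB => ?_
  obtain ⟨v, hv⟩ := hatt B hB
  have hvB : v ∈ B := (Finset.mem_inter.1 hv).1
  have hvQ : v ∈ Q := (Finset.mem_inter.1 hv).2
  have hvo : v ≠ o := fun h => hoA (h ▸ hQA hvQ)
  have ha₀o : a₀ ≠ o := fun h => hoA (h ▸ hQA ha₀)
  exact KozmaNitzan2024_lemma5_fintype w o b a₀ v (↑B : Set V) ha₀o hvo (Finset.mem_coe.2 hvB)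
    (hmin v hvQ)

/-- **Post-FKG inequality on an up-set attached to `Q`.**  `0` isolated in `G ∖ A`, `Q ⊆ A` nonempty,
`𝒰 ⊆ 𝒫(A)` an up-set every member of which meets `Q`.  Then
`min_{a ∈ Q} P(a ↔ b) · P(U) ≤ P(0 ↔ b, U)`, i.e. `P(0 ↔ b | U) ≥ min_{a ∈ Q} P(a ↔ b)`: the ports
outside `Q` are spectators.  (`Q = A`: `upset_postFKG`.) [cite: KozmaNitzan2024, Lemma 5 (p. 13), Conjecture 1 (p. 3); this form: route notes FINDINGS-fat-minority-gen10] -/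
theorem upset_postFKG_attached (w : Sym2 V → unitInterval) (A Q : Finset V) (hQ : Q.Nonempty) (o b : V)
    (hoA : o ∉ A) (hiso : ∀ u, u ≠ o → u ∉ A → w s(o, u) = 0)
    (𝒰 : Finset (Finset V)) (h𝒰A : 𝒰 ⊆ A.powerset)
    (hup : ∀ B ∈ 𝒰, ∀ B' ∈ A.powerset, B ⊆ B' → B' ∈ 𝒰)
    (hQA : Q ⊆ A) (hatt : ∀ B ∈ 𝒰, (B ∩ Q).Nonempty) :
    (Q.inf' hQ fun a => (prodBernoulli w).real (openConn a b)) *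
        (prodBernoulli w).real ({ω : BondConfig V | ∃ B ∈ 𝒰, ∀ u ∈ B, s(o, u) ∈ ω}) ≤
      (prodBernoulli w).real (openConn o b ∩ {ω : BondConfig V | ∃ B ∈ 𝒰, ∀ u ∈ B, s(o, u) ∈ ω}) := by
  set μ := prodBernoulli w with hμ
  obtain ⟨a₀, ha₀, hmin⟩ :=
    Q.exists_min_image (fun a => μ.real (openConnIn ({o}ᶜ : Set V) a b)) hQ
  have h1 := upset_thm4_comparison_attached w A Q o b hoA hiso 𝒰 h𝒰A hup hQA hatt ha₀ hmin
  have hH : μ.real (openConn a₀ b) * μ.real ({ω : BondConfig V | ∃ B ∈ 𝒰, ∀ u ∈ B, s(o, u) ∈ ω}) ≤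
      μ.real (openConn a₀ b ∩ {ω : BondConfig V | ∃ B ∈ 𝒰, ∀ u ∈ B, s(o, u) ∈ ω}) :=
    prodBernoulli_harris w (isUpperSet_openConn a₀ b) (isUpperSet_starUpEvent o 𝒰)
      MeasurableSet.of_discrete MeasurableSet.of_discrete
  have hinf : Q.inf' hQ (fun a => μ.real (openConn a b)) ≤ μ.real (openConn a₀ b) :=
    Finset.inf'_le _ ha₀
  have hU : 0 ≤ μ.real ({ω : BondConfig V | ∃ B ∈ 𝒰, ∀ u ∈ B, s(o, u) ∈ ω}) := measureReal_nonneg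
  calc (Q.inf' hQ fun a => μ.real (openConn a b)) * μ.real ({ω : BondConfig V | ∃ B ∈ 𝒰, ∀ u ∈ B, s(o, u) ∈ ω})
      ≤ μ.real (openConn a₀ b) * μ.real ({ω : BondConfig V | ∃ B ∈ 𝒰, ∀ u ∈ B, s(o, u) ∈ ω}) :=
        mul_le_mul_of_nonneg_right hinf hU
    _ ≤ μ.real (openConn a₀ b ∩ {ω : BondConfig V | ∃ B ∈ 𝒰, ∀ u ∈ B, s(o, u) ∈ ω}) := hH
    _ ≤ μ.real (openConn o b ∩ {ω : BondConfig V | ∃ B ∈ 𝒰, ∀ u ∈ B, s(o, u) ∈ ω}) := h1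

/-- **(PF+), the generator form of the post-FKG inequality on every up-set.**  `0` isolated in `G ∖ A`,
`𝒰 ⊆ 𝒫(A)` a nonempty up-set with `∅ ∉ 𝒰`, and
`s(𝒰) := min_{B ∈ 𝒰} max_{v ∈ B} P(v ↔ b)` (the best port of the worst member; the minimum is attained
on a minimal member).  Then `s(𝒰) · P(U) ≤ P(0 ↔ b, U)`.  Proof: `upset_postFKG_attached` with `Q` the set
of `P(· ↔ b)`-best ports of the members of `𝒰`. [cite: KozmaNitzan2024, Lemma 5 (p. 13); this statement: route notes FINDINGS-fat-minority-gen9 §4 (PF+), proof FINDINGS-fat-minority-gen10] -/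
theorem upset_postFKG_generators (w : Sym2 V → unitInterval) (A : Finset V) (o b : V)
    (hoA : o ∉ A) (hiso : ∀ u, u ≠ o → u ∉ A → w s(o, u) = 0)
    (𝒰 : Finset (Finset V)) (h𝒰 : 𝒰.Nonempty) (h𝒰A : 𝒰 ⊆ A.powerset)
    (hup : ∀ B ∈ 𝒰, ∀ B' ∈ A.powerset, B ⊆ B' → B' ∈ 𝒰) (h0 : ∅ ∉ 𝒰) :
    (𝒰.inf' h𝒰 fun B => if hB : B.Nonempty then B.sup' hB (fun v => (prodBernoulli w).real (openConn v b)) else 0) *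
        (prodBernoulli w).real ({ω : BondConfig V | ∃ B ∈ 𝒰, ∀ u ∈ B, s(o, u) ∈ ω}) ≤
      (prodBernoulli w).real (openConn o b ∩ {ω : BondConfig V | ∃ B ∈ 𝒰, ∀ u ∈ B, s(o, u) ∈ ω}) := by
  set μ := prodBernoulli w with hμ
  set R : V → ℝ := fun v => μ.real (openConn v b) with hR
  have hne : ∀ B ∈ 𝒰, B.Nonempty := fun B hB =>
    Finset.nonempty_iff_ne_empty.2 fun h => h0 (h ▸ hB)
  -- the best port of each member
  let vb : Finset V → V := fun B =>
    if hB : B.Nonempty then Classical.choose (Finset.exists_max_image B R hB) else o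
  have hvbB : ∀ B ∈ 𝒰, vb B ∈ B := fun B hB => by
    simp only [vb, dif_pos (hne B hB)]
    exact (Classical.choose_spec (Finset.exists_max_image B R (hne B hB))).1
  have hvbmax : ∀ B ∈ 𝒰, ∀ u ∈ B, R u ≤ R (vb B) := fun B hB => by
    simp only [vb, dif_pos (hne B hB)]
    exact (Classical.choose_spec (Finset.exists_max_image B R (hne B hB))).2
  set Q : Finset V := 𝒰.image vb with hQdef
  obtain ⟨B₁, hB₁⟩ := h𝒰
  have hQ : Q.Nonempty := ⟨vb B₁, Finset.mem_image_of_mem vb hB₁⟩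
  have hQA : Q ⊆ A := by
    intro v hv
    obtain ⟨B, hB, rfl⟩ := Finset.mem_image.1 hv
    exact Finset.mem_powerset.1 (h𝒰A hB) (hvbB B hB)
  have hatt : ∀ B ∈ 𝒰, (B ∩ Q).Nonempty := fun B hB =>
    ⟨vb B, Finset.mem_inter.2 ⟨hvbB B hB, Finset.mem_image_of_mem vb hB⟩⟩
  have h1 := upset_postFKG_attached w A Q hQ o b hoA hiso 𝒰 h𝒰A hup hQA hatt
  -- `s(𝒰) ≤ min_Q P(· ↔ b)`
  have hs : (𝒰.inf' ⟨B₁, hB₁⟩ fun B => if hB : B.Nonempty then B.sup' hB R else 0) ≤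
      Q.inf' hQ fun a => R a := by
    refine Finset.le_inf' hQ _ fun a ha => ?_
    obtain ⟨B, hB, rfl⟩ := Finset.mem_image.1 ha
    refine (Finset.inf'_le _ hB).trans ?_
    rw [dif_pos (hne B hB)]
    exact Finset.sup'_le (hne B hB) R (hvbmax B hB)
  have hU : 0 ≤ μ.real ({ω : BondConfig V | ∃ B ∈ 𝒰, ∀ u ∈ B, s(o, u) ∈ ω}) := measureReal_nonneg
  exact (mul_le_mul_of_nonneg_right hs hU).trans h1

end

end Summit.CriticalPhenomena.PercolationContinuityZ3.Theorems
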